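import Summits.QuantumFields.YangMills.Theorems.FluctuationComparisonRegPrIntLS2BetaPivotResolveSmooth
import HarnessLib

/-!
# S2β · LAPLACE row — (C2′): THE PARAMETRIC PIVOT RE-SOLVE — a FAMILY of window charts along a jointly smooth family of fields, with a MOVING coarse target (pen w5-20520 g14)

Cell `ym3-torus` (rung R3: continuum `SU(2)` Yang–Mills on `T³` — NOT `d = 4`, NOT infinite volume, NOT a mass gap, NOT Clay); width seat `ym-ust-20520-w5` g14;
helper of the crux `stmt-QuantumFields-20520` (`--supports`, NOT a proof of it).  THEOREMS ONLY (0 `def`, 0 `sorry`; default heartbeats); generic `(P, N)`.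

WHY (FOUR-POINT-DECAY, LINE g18-1 `Lines/semiclassical_s2beta.lean` v9, the last LAPLACE residue).  The route of record ✓(D2)∘✓(D3)
`…S2BetaDecayLogDet.abs_fourPt_log_oneLoopConst_le_of_rectangle` reads the four corner constants `ℓ_x = c₀·P_x∕√det Ah_x` on ONE space in ONE basis, through a
`C¹` rectangle of slice Hessians `M(s,t) = Ah_{x(s,t)}` along the one-bond interpolations `x(s,t)` of the quadrilateral.  In the COMMON TUBE of the corner `U`
(transversal `σ_U` of the minimiser `U₀^U`), `Ah_{x'} = Hess_y A(c.Φ(x', σ_U y))` at the transversal coordinate `y(x')` of the minimiser orbit of the datum `x'`; so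
the rectangle needs the joint smoothness of `(x', y) ↦ A(c.Φ(x', σ_U y))` — i.e. ✓(C2-c) `…PivotResolveSmooth.contDiffAt_wilsonAction4_resolve` with the chart, the
field AND the coarse target MOVING with a parameter.  THIS FILE is that parametric edition; (C2-a)∕(C2-c) are its special case of a constant chart and target.

WHAT.  Parameter space `Pm` (real Banach); a continuous family `σ̂ : Pm → SU(N)^{bonds}` through `σ̂ 0 = U₀` with `C^∞` matrix field at `0`; a target
`T : Pm → SU(N)^{coarse bonds}` with `T 0 = Ū⁽ⁿ⁾ U₀` and `C^∞` matrix field; the PARAMETRIC PIVOT-READ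
  `R̂(p, X) := (c ↦ Λ(Ū⁽ⁿ⁾((σ̂ p)[βₙ c' ↦ Θ(X c')·U₀(βₙ c')]) c · (T p c)⁻¹))`.
* §1 ★★ `contDiffAt_pivotRead_param`: `R̂` is `C^∞` at `(0,0)` under `SmallBelow n U₀` (✓(C2-a)'s ambient argument, the reference `Ū⁽ⁿ⁾ U₀` replaced by the smooth `T`);
  `pivotReadParam_base_eq_chainMap`: `R̂(0, X) c = Λ(chainMap ℰ n U₀ c (Θ(X c)·U₀(βₙ c)) · (Ū⁽ⁿ⁾ U₀ c)⁻¹)` — px11 g10's (C2-b) shape.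
* §2 ★★★ `contDiffAt_coeField_resolve_param`: for a FAMILY of charts `Φ̂ : Pm → (SU(N)^{bonds} → SU(N)^{bonds})` with, EVENTUALLY along the family, off-pivot agreement
  `Φ̂ p (σ̂ p) = σ̂ p` off `βₙ`, the fibre row `Ū⁽ⁿ⁾(Φ̂ p (σ̂ p)) = T p`, continuity of `p ↦ Φ̂ p (σ̂ p)` at `0`, `Φ̂ 0 U₀ = U₀`, and the (C2-b) row `hinv` at `(0,0)`:
  `p ↦ ↑(Φ̂ p (σ̂ p))` is `C^∞` at `0` (lit ✓`FixedPointSmoothDependence.contDiffAt_of_implicitZero'`); ★★★ `contDiffAt_wilsonAction4_resolve_param`: so is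
  `p ↦ A(Φ̂ p (σ̂ p))`; `isInvertible_inr_param_of_blocks`: `hinv` from the per-bond (C2-b) row (✓`isInvertible_inr_of_blocks`).

HONEST SCOPE.  Implicit-function assembly; (C2-b) and every localisation∕decay estimate of FOUR-POINT-DECAY stay elsewhere; proves no stub; EXW ∕ GAP♯ ∕ FOUR-POINT-DECAY ∕
H4ᶜ ∕ LFR♯ᶜ ∕ LAPLACE ∕ S2β ∕ the crux 20520 NOT proved; `YM3TorusSU2` NOT proved; the Yang–Mills mass gap (Clay) NOT proved.

References: [Balaban1987RG1] CMP 109 (1987) (0.4) p. 253, p. 267 (after (2.10)); [Balaban1985Variational] CMP 102 (1985) (5) p. 278, Thm 1 (8)–(10) p. 279;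
[Dieudonne1960] Ch. X §2 (10.2.1)–(10.2.3); [Helgason2000] Ch. I §1 Thm 1.14 p. 96.
-/

noncomputable section

open scoped Matrix.Norms.L2Operator Topology ContDiff
open Filter Set Function
open Literature.MathematicalPhysics.QuantumFieldTheory.Balaban1983to89
open Literature.MathematicalPhysics.QuantumFieldTheory.Balaban1983to89.HaarExponentialChart
open Literature.MathematicalPhysics.QuantumFieldTheory.Balaban1983to89.HaarExponentialChart.IsChartRep
open Literature.MathematicalPhysics.QuantumFieldTheory.Balaban1983to89.BlockAveraging (Small Idx avgFun loopHol blockAvg blockAvg_avg)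
open Literature.MathematicalPhysics.QuantumFieldTheory.Balaban1983to89.ExpMeanLog (expMeanLogSU deltaSU)
open Literature.MathematicalPhysics.QuantumFieldTheory.Balaban1983to89.Node00
open Literature.MathematicalPhysics.QuantumLattice (fundamentalRep fundamentalRep_apply)
open MatrixLog (mlog analyticAt_mlog mlog_one)
open Literature.Analysis.Calculus (contDiffAt_of_implicitZero')
open Summit.QuantumFields.YangMills.BalabanUVNodes.N09ChartReadAveragingSmooth (contDiffAt_of_coe)
open Summit.QuantumFields.YangMills.Theorems.FluctuationComparisonRegPrIntLWregChain (iterCentralBond iterCentralBond_injective chainMap)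
open Summit.QuantumFields.YangMills.Theorems.FluctuationComparisonRegPrIntLS2BetaPivotReadSmooth
open Summit.QuantumFields.YangMills.Theorems.FluctuationComparisonRegPrIntLS2BetaPivotResolveSmooth

namespace Summit.QuantumFields.YangMills.Theorems.FluctuationComparisonRegPrIntLS2BetaPivotResolveParam

variable {P : Params} {N : ℕ} [NeZero N]
variable {Pm : Type*} [NormedAddCommGroup Pm] [NormedSpace ℝ Pm]

/-! ## §1 The parametric pivot-read is `C^∞` at `(0, 0)` -/

/-- ★★ **(C2′-a) THE PARAMETRIC PIVOT-READ IS JOINTLY `C^∞`.**  As ✓`…PivotReadSmooth.contDiffAt_pivotRead`, with the reference coarse field `Ū⁽ⁿ⁾ U₀` replaced by a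
MOVING target `T p` (`T 0 = Ū⁽ⁿ⁾ U₀`, `C^∞` matrix field): `(p, X) ↦ (c ↦ Λ(Ū⁽ⁿ⁾((σ̂ p)[βₙ c' ↦ Θ(X c')·U₀(βₙ c')]) c · (T p c)⁻¹))` is `C^∞` at `(0, 0)`.
[cite: Balaban1987RG1, (0.4) p.253 («analytic function») and (0.21) p.256] [cite: Dieudonne1960, Ch. X §2 (10.2.1)] -/
theorem contDiffAt_pivotRead_param {n : ℕ} (U₀ : GaugeField P 0 (SU N))
    (hU₀ : SmallBelow (fun j => blockAvg (P := P) (j := j) (expMeanLogSU (n := Fin N))) n U₀)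
    (σ : Pm → GaugeField P 0 (SU N)) (hσc : Continuous σ) (hσ0 : σ 0 = U₀) (hσs : ContDiffAt ℝ ⊤ (fun p => coeField (σ p)) 0)
    (T : Pm → GaugeField P n (SU N)) (hT0 : T 0 = Averaging.iter (fun j => blockAvg (P := P) (j := j) (expMeanLogSU (n := Fin N))) n U₀)
    (hTs : ContDiffAt ℝ ⊤ (fun p => coeField (T p)) 0) :
    ContDiffAt ℝ ⊤ (fun q : Pm × (PBond P n → (specialUnitaryLogChart (Fin N)).lie) => fun c : PBond P n =>
      (isChartRep_specialUnitaryGroup (n := Fin N)).logChart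
        (Averaging.iter (fun j => blockAvg (P := P) (j := j) (expMeanLogSU (n := Fin N))) n
            (extend (iterCentralBond n) (fun c' => (isChartRep_specialUnitaryGroup (n := Fin N)).expChart (q.2 c') * U₀ (iterCentralBond n c')) (σ q.1)) c *
          (T q.1 c)⁻¹)) (0, 0) := by
  classical
  set h := isChartRep_specialUnitaryGroup (n := Fin N) with hh
  set Wp : Pm × (PBond P n → (specialUnitaryLogChart (Fin N)).lie) → GaugeField P 0 (SU N) :=
    fun q => extend (iterCentralBond n) (fun c' => h.expChart (q.2 c') * U₀ (iterCentralBond n c')) (σ q.1) with hWp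
  set F : Pm × (PBond P n → (specialUnitaryLogChart (Fin N)).lie) → PBond P 0 → Matrix (Fin N) (Fin N) ℂ :=
    fun q => extend (iterCentralBond n) (fun c' => NormedSpace.exp (((q.2 c' : (specialUnitaryLogChart (Fin N)).lie) : Matrix (Fin N) (Fin N) ℂ)) *
      ((U₀ (iterCentralBond n c') : SU N) : Matrix (Fin N) (Fin N) ℂ)) (coeField (σ q.1)) with hF
  have hcoeW : ∀ q, coeField (Wp q) = F q := fun q => coeField_pivotInsert U₀ (σ q.1) q.2
  have hW0 : Wp (0, 0) = U₀ := by
    show extend (iterCentralBond n) (fun c' => h.expChart ((0 : PBond P n → (specialUnitaryLogChart (Fin N)).lie) c') * U₀ (iterCentralBond n c')) (σ 0) = U₀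
    rw [hσ0]; exact pivotInsert_zero U₀
  have hF0 : F (0, 0) = coeField U₀ := by rw [← hcoeW, hW0]
  have hFs : ContDiffAt ℝ ⊤ F (0, 0) := contDiffAt_ambientPivotField U₀ σ hσs
  have hWc : Continuous Wp := continuous_pivotInsert U₀ σ hσc
  -- the guard holds near `(0,0)`
  obtain ⟨-, hgev⟩ := continuousAt_iter_and_eventually_smallBelow n U₀ hU₀
  have hguard : ∀ᶠ q in 𝓝 ((0 : Pm), (0 : PBond P n → (specialUnitaryLogChart (Fin N)).lie)),
      SmallBelow (fun j => blockAvg (P := P) (j := j) (expMeanLogSU (n := Fin N))) n (Wp q) := by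
    have ht : Tendsto Wp (𝓝 (0, 0)) (𝓝 U₀) := by rw [← hW0]; exact hWc.continuousAt
    exact ht.eventually hgev
  -- the ambient iterate is smooth at `(0,0)`
  have hiter : ContDiffAt ℝ ⊤ (fun q => iterM n (F q)) ((0 : Pm), (0 : PBond P n → (specialUnitaryLogChart (Fin N)).lie)) := by
    have hg : ContDiffAt ℝ ⊤ (iterM n : (PBond P 0 → Matrix (Fin N) (Fin N) ℂ) → PBond P n → Matrix (Fin N) (Fin N) ℂ) (F (0, 0)) := by
      rw [hF0]; exact contDiffAt_iterM n hU₀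
    exact hg.comp (0, 0) hFs
  have hcoe0 : coeField (Averaging.iter (fun j => blockAvg (P := P) (j := j) (expMeanLogSU (n := Fin N))) n U₀) = iterM n (coeField U₀) :=
    coeField_iter_eq_iterM n hU₀
  -- the moving reference: `q ↦ (↑(T q.1 c))⋆` is smooth
  have hstar : ∀ c : PBond P n, ContDiffAt ℝ ⊤ (fun q : Pm × (PBond P n → (specialUnitaryLogChart (Fin N)).lie) =>
      star (coeField (T q.1) c)) ((0 : Pm), (0 : PBond P n → (specialUnitaryLogChart (Fin N)).lie)) := by
    intro c
    have h1 : ContDiffAt ℝ ⊤ (fun q : Pm × (PBond P n → (specialUnitaryLogChart (Fin N)).lie) => coeField (T q.1)) (0, 0) :=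
      ContDiffAt.comp (g := fun p => coeField (T p)) (f := Prod.fst) ((0 : Pm), (0 : PBond P n → (specialUnitaryLogChart (Fin N)).lie)) hTs contDiffAt_fst
    have h2 : ContDiffAt ℝ ⊤ (fun q : Pm × (PBond P n → (specialUnitaryLogChart (Fin N)).lie) => coeField (T q.1) c) (0, 0) := (contDiffAt_pi.1 h1) c
    exact ((starL' ℝ : Matrix (Fin N) (Fin N) ℂ ≃L[ℝ] Matrix (Fin N) (Fin N) ℂ).contDiff.contDiffAt).comp (0, 0) h2
  refine contDiffAt_pi.2 fun c => contDiffAt_of_coe (specialUnitaryLogChart (Fin N)).lie ?_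
  -- the smooth model of the `c`-component: `mlog (iterM n (F q) c · (↑(T q.1 c))⋆)`
  have hM : ContDiffAt ℝ ⊤ (fun q => iterM n (F q) c * star (coeField (T q.1) c)) ((0 : Pm), (0 : PBond P n → (specialUnitaryLogChart (Fin N)).lie)) :=
    ((contDiffAt_pi.1 hiter) c).mul (hstar c)
  have hM0 : iterM n (F (0, 0)) c * star (coeField (T 0) c) = 1 := by
    rw [hF0, ← hcoe0, hT0]
    exact coe_mul_star_coe_SU _
  have hmlog : ContDiffAt ℝ ⊤ (fun q => mlog (iterM n (F q) c * star (coeField (T q.1) c))) ((0 : Pm), (0 : PBond P n → (specialUnitaryLogChart (Fin N)).lie)) := by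
    have ha : ContDiffAt ℝ ⊤ (fun Y : Matrix (Fin N) (Fin N) ℂ => mlog Y) (iterM n (F (0, 0)) c * star (coeField (T (0 : Pm)) c)) := by
      rw [hM0]
      exact ((analyticAt_mlog (X := (1 : Matrix (Fin N) (Fin N) ℂ)) (by simp)).contDiffAt).restrict_scalars ℝ
    exact ContDiffAt.comp (g := fun Y : Matrix (Fin N) (Fin N) ℂ => mlog Y) (f := fun q => iterM n (F q) c * star (coeField (T q.1) c))
      ((0 : Pm), (0 : PBond P n → (specialUnitaryLogChart (Fin N)).lie)) ha hM
  -- near `(0,0)` the relative matrix is inside the logarithmic chart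
  have hnear : ∀ᶠ q in 𝓝 ((0 : Pm), (0 : PBond P n → (specialUnitaryLogChart (Fin N)).lie)),
      ‖iterM n (F q) c * star (coeField (T q.1) c) - 1‖ < innerRadius (specialUnitaryLogChart (Fin N)) := by
    have hc : ContinuousAt (fun q => ‖iterM n (F q) c * star (coeField (T q.1) c) - 1‖)
        ((0 : Pm), (0 : PBond P n → (specialUnitaryLogChart (Fin N)).lie)) :=
      continuous_norm.continuousAt.comp (hM.continuousAt.sub continuousAt_const)
    refine hc.eventually (isOpen_Iio.mem_nhds ?_)
    show ‖iterM n (F (0, 0)) c * star (coeField (T (0 : Pm)) c) - 1‖ < _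
    rw [hM0, sub_self, norm_zero]; exact innerRadius_pos
  -- identification of the coercion with the smooth model near `(0,0)`
  have heq : (fun q => ((h.logChart
      (Averaging.iter (fun j => blockAvg (P := P) (j := j) (expMeanLogSU (n := Fin N))) n (Wp q) c * (T q.1 c)⁻¹) :
        (specialUnitaryLogChart (Fin N)).lie) : Matrix (Fin N) (Fin N) ℂ)) =ᶠ[𝓝 ((0 : Pm), (0 : PBond P n → (specialUnitaryLogChart (Fin N)).lie))]
      fun q => mlog (iterM n (F q) c * star (coeField (T q.1) c)) := by
    filter_upwards [hguard, hnear] with q hq hqn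
    have hcoeI : ((Averaging.iter (fun j => blockAvg (P := P) (j := j) (expMeanLogSU (n := Fin N))) n (Wp q) c : SU N) : Matrix (Fin N) (Fin N) ℂ) =
        iterM n (F q) c := by
      rw [← hcoeW q, ← coeField_iter_eq_iterM n hq]; rfl
    have hrel : ((Averaging.iter (fun j => blockAvg (P := P) (j := j) (expMeanLogSU (n := Fin N))) n (Wp q) c * (T q.1 c)⁻¹ : SU N) :
        Matrix (Fin N) (Fin N) ℂ) = iterM n (F q) c * star (coeField (T q.1) c) := by
      rw [Submonoid.coe_mul, coe_inv_SU, hcoeI]; rfl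
    have hρ : ‖fundamentalRep (Fin N) (Averaging.iter (fun j => blockAvg (P := P) (j := j) (expMeanLogSU (n := Fin N))) n (Wp q) c * (T q.1 c)⁻¹) - 1‖ <
        innerRadius (specialUnitaryLogChart (Fin N)) := by
      rw [fundamentalRep_apply, hrel]; exact hqn
    rw [h.coe_logChart hρ, fundamentalRep_apply, hrel]
  exact hmlog.congr_of_eventuallyEq heq

omit [NormedSpace ℝ Pm] in
/-- **THE DOCKING IDENTITY AT THE BASE PARAMETER**: at `p = 0` the parametric read is the one-variable chart-read chain of px11 g10's (C2-b), bond by bond.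
[cite: Balaban1987RG1, p.267 (after (2.10))] -/
theorem pivotReadParam_base_eq_chainMap {n : ℕ} (hn : n ≤ P.m + P.K) (U₀ : GaugeField P 0 (SU N))
    (σ : Pm → GaugeField P 0 (SU N)) (hσ0 : σ 0 = U₀)
    (T : Pm → GaugeField P n (SU N)) (hT0 : T 0 = Averaging.iter (fun j => blockAvg (P := P) (j := j) (expMeanLogSU (n := Fin N))) n U₀)
    (X : PBond P n → (specialUnitaryLogChart (Fin N)).lie) (c : PBond P n) :
    (isChartRep_specialUnitaryGroup (n := Fin N)).logChart
        (Averaging.iter (fun j => blockAvg (P := P) (j := j) (expMeanLogSU (n := Fin N))) n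
            (extend (iterCentralBond n) (fun c' => (isChartRep_specialUnitaryGroup (n := Fin N)).expChart (X c') * U₀ (iterCentralBond n c')) (σ 0)) c *
          (T 0 c)⁻¹) =
      (isChartRep_specialUnitaryGroup (n := Fin N)).logChart
        (chainMap (expMeanLogSU (n := Fin N)) n U₀ c ((isChartRep_specialUnitaryGroup (n := Fin N)).expChart (X c) * U₀ (iterCentralBond n c)) *
          (Averaging.iter (fun j => blockAvg (P := P) (j := j) (expMeanLogSU (n := Fin N))) n U₀ c)⁻¹) := by
  rw [hσ0, hT0]
  exact pivotRead_base_eq_chainMap hn U₀ X c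

/-! ## §2 The parametric re-solve is `C^∞` along the family -/

section Resolve

variable [CompleteSpace Pm]

/-- ★★★ **(C2′-c) THE MATRIX FIELD OF THE RE-SOLVED FAMILY IS `C^∞` IN THE PARAMETER.**  Data: the guard at `U₀`; a continuous family `σ̂` through `σ̂ 0 = U₀` with `C^∞`
matrix field; a smooth-matrix target `T` with `T 0 = Ū⁽ⁿ⁾ U₀`; a FAMILY of maps `Φ̂ p` (the window charts at the moving datum) such that, for `p` near `0`, `Φ̂ p (σ̂ p)`
agrees with `σ̂ p` off the pivots and averages to `T p`; `p ↦ Φ̂ p (σ̂ p)` continuous at `0`; `Φ̂ 0 U₀ = U₀`; and the (C2-b) row at `(0,0)`.  Then `p ↦ ↑(Φ̂ p (σ̂ p))` is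
`C^∞` at `0` (pivot log-coordinates are a continuous family of zeros of the `C^∞` parametric read; lit ✓`contDiffAt_of_implicitZero'`).
[cite: Dieudonne1960, Ch. X §2 (10.2.1)–(10.2.3)] [cite: Balaban1987RG1, p.267 (after (2.10))] -/
theorem contDiffAt_coeField_resolve_param {n : ℕ} (U₀ : GaugeField P 0 (SU N))
    (hU₀ : SmallBelow (fun j => blockAvg (P := P) (j := j) (expMeanLogSU (n := Fin N))) n U₀)
    (σ : Pm → GaugeField P 0 (SU N)) (hσc : Continuous σ) (hσ0 : σ 0 = U₀) (hσs : ContDiffAt ℝ ⊤ (fun p => coeField (σ p)) 0)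
    (T : Pm → GaugeField P n (SU N)) (hT0 : T 0 = Averaging.iter (fun j => blockAvg (P := P) (j := j) (expMeanLogSU (n := Fin N))) n U₀)
    (hTs : ContDiffAt ℝ ⊤ (fun p => coeField (T p)) 0)
    (Φ : Pm → GaugeField P 0 (SU N) → GaugeField P 0 (SU N))
    (hoff : ∀ᶠ p in 𝓝 0, ∀ b, (∀ c, iterCentralBond n c ≠ b) → Φ p (σ p) b = σ p b)
    (hfib : ∀ᶠ p in 𝓝 0, Averaging.iter (fun j => blockAvg (P := P) (j := j) (expMeanLogSU (n := Fin N))) n (Φ p (σ p)) = T p)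
    (hΦc : ContinuousAt (fun p => Φ p (σ p)) 0) (hself : Φ 0 U₀ = U₀)
    (hinv : ((fderiv ℝ (fun q : Pm × (PBond P n → (specialUnitaryLogChart (Fin N)).lie) => fun c : PBond P n =>
        (isChartRep_specialUnitaryGroup (n := Fin N)).logChart
          (Averaging.iter (fun j => blockAvg (P := P) (j := j) (expMeanLogSU (n := Fin N))) n
              (extend (iterCentralBond n) (fun c' => (isChartRep_specialUnitaryGroup (n := Fin N)).expChart (q.2 c') * U₀ (iterCentralBond n c')) (σ q.1)) c *
            (T q.1 c)⁻¹)) (0, 0)).comp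
        (ContinuousLinearMap.inr ℝ Pm (PBond P n → (specialUnitaryLogChart (Fin N)).lie))).IsInvertible) :
    ContDiffAt ℝ ⊤ (fun p => coeField (Φ p (σ p))) 0 := by
  classical
  haveI : CompleteSpace (specialUnitaryLogChart (Fin N)).lie := FiniteDimensional.complete ℝ _
  set h := isChartRep_specialUnitaryGroup (n := Fin N) with hh
  set R : Pm × (PBond P n → (specialUnitaryLogChart (Fin N)).lie) → PBond P n → (specialUnitaryLogChart (Fin N)).lie :=
    fun q c => h.logChart (Averaging.iter (fun j => blockAvg (P := P) (j := j) (expMeanLogSU (n := Fin N))) n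
      (extend (iterCentralBond n) (fun c' => h.expChart (q.2 c') * U₀ (iterCentralBond n c')) (σ q.1)) c * (T q.1 c)⁻¹) with hR
  set θ : Pm → PBond P n → (specialUnitaryLogChart (Fin N)).lie :=
    fun p c => h.logChart (Φ p (σ p) (iterCentralBond n c) * (U₀ (iterCentralBond n c))⁻¹) with hθ
  have hΦ0 : Φ 0 (σ 0) = U₀ := by rw [hσ0, hself]
  -- `θ 0 = 0`
  have hθ0 : θ 0 = 0 := by
    funext c
    show h.logChart (Φ 0 (σ 0) (iterCentralBond n c) * (U₀ (iterCentralBond n c))⁻¹) = 0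
    rw [hΦ0, mul_inv_cancel, h.logChart_one]
  -- the relative pivot values tend to `1`
  have hΦσ : Tendsto (fun p => Φ p (σ p)) (𝓝 0) (𝓝 U₀) := by
    have := hΦc.tendsto; rwa [hΦ0] at this
  have hrel : ∀ c, Tendsto (fun p => Φ p (σ p) (iterCentralBond n c) * (U₀ (iterCentralBond n c))⁻¹) (𝓝 0) (𝓝 1) := by
    intro c
    have h1 : Tendsto (fun p => Φ p (σ p) (iterCentralBond n c)) (𝓝 0) (𝓝 (U₀ (iterCentralBond n c))) :=
      ((continuous_apply (iterCentralBond n c)).tendsto U₀).comp hΦσ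
    have h2 := h1.mul (tendsto_const_nhds (x := (U₀ (iterCentralBond n c))⁻¹))
    rwa [mul_inv_cancel] at h2
  have hin : ∀ c, ∀ᶠ p in 𝓝 (0 : Pm), ‖((Φ p (σ p) (iterCentralBond n c) * (U₀ (iterCentralBond n c))⁻¹ : SU N) : Matrix (Fin N) (Fin N) ℂ) - 1‖ <
      innerRadius (specialUnitaryLogChart (Fin N)) := by
    intro c
    have hcont : Continuous fun g' : SU N => ‖((g' : SU N) : Matrix (Fin N) (Fin N) ℂ) - 1‖ :=
      continuous_norm.comp (continuous_subtype_val.sub continuous_const)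
    have hc : Tendsto (fun p => ‖((Φ p (σ p) (iterCentralBond n c) * (U₀ (iterCentralBond n c))⁻¹ : SU N) : Matrix (Fin N) (Fin N) ℂ) - 1‖) (𝓝 0) (𝓝 0) := by
      have h1 : ‖((1 : SU N) : Matrix (Fin N) (Fin N) ℂ) - 1‖ = 0 := by rw [OneMemClass.coe_one, sub_self, norm_zero]
      have := (hcont.tendsto (1 : SU N)).comp (hrel c)
      rw [h1] at this
      exact this
    exact (hc.eventually (gt_mem_nhds innerRadius_pos))
  have hθc : ContinuousAt θ 0 := by
    refine continuousAt_pi.2 fun c => ?_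
    have h1 : ContinuousAt h.logChart (1 : SU N) := continuousAt_logChart (by rw [OneMemClass.coe_one, sub_self, norm_zero]; exact innerRadius_pos)
    have h0 : Φ 0 (σ 0) (iterCentralBond n c) * (U₀ (iterCentralBond n c))⁻¹ = 1 := by rw [hΦ0, mul_inv_cancel]
    have h2 : ContinuousAt (fun p => Φ p (σ p) (iterCentralBond n c) * (U₀ (iterCentralBond n c))⁻¹) 0 := by
      rw [ContinuousAt, h0]; exact hrel c
    exact ContinuousAt.comp_of_eq h1 h2 h0
  -- inserting `Θ(θ p)·U₀∘βₙ` into `σ p` gives back `Φ p (σ p)`, for `p` near `0`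
  have hins : ∀ᶠ p in 𝓝 (0 : Pm),
      extend (iterCentralBond n) (fun c' => h.expChart (θ p c') * U₀ (iterCentralBond n c')) (σ p) = Φ p (σ p) := by
    filter_upwards [hoff, Filter.eventually_all.2 hin] with p hpoff hpin
    have hval : (fun c' => h.expChart (θ p c') * U₀ (iterCentralBond n c')) = fun c' => Φ p (σ p) (iterCentralBond n c') := by
      funext c'
      have hρ : ‖fundamentalRep (Fin N) (Φ p (σ p) (iterCentralBond n c') * (U₀ (iterCentralBond n c'))⁻¹) - 1‖ <
          innerRadius (specialUnitaryLogChart (Fin N)) := by rw [fundamentalRep_apply]; exact hpin c'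
      show h.expChart (h.logChart (Φ p (σ p) (iterCentralBond n c') * (U₀ (iterCentralBond n c'))⁻¹)) * U₀ (iterCentralBond n c') = _
      rw [h.expChart_logChart hρ, inv_mul_cancel_right]
    rw [hval]
    exact extend_pivots_eq_of_offPivot (iterCentralBond n) hpoff
  have hzero : ∀ᶠ p in 𝓝 (0 : Pm), R (p, θ p) = R (0, θ 0) := by
    have hR0 : R (0, θ 0) = 0 := by
      funext c
      show h.logChart (Averaging.iter (fun j => blockAvg (P := P) (j := j) (expMeanLogSU (n := Fin N))) n
        (extend (iterCentralBond n) (fun c' => h.expChart (θ 0 c') * U₀ (iterCentralBond n c')) (σ 0)) c * (T 0 c)⁻¹) = 0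
      rw [hθ0, hσ0, hT0, pivotInsert_zero, mul_inv_cancel, h.logChart_one]
    rw [hR0]
    filter_upwards [hins, hfib] with p hp hpf
    funext c
    show h.logChart (Averaging.iter (fun j => blockAvg (P := P) (j := j) (expMeanLogSU (n := Fin N))) n
      (extend (iterCentralBond n) (fun c' => h.expChart (θ p c') * U₀ (iterCentralBond n c')) (σ p)) c * (T p c)⁻¹) = 0
    rw [hp, hpf, mul_inv_cancel, h.logChart_one]
  -- the parametric read is `C^∞` at `(0, θ 0) = (0,0)` with invertible pivot-derivative there
  have hRs : ContDiffAt ℝ ⊤ R (0, θ 0) := by rw [hθ0]; exact contDiffAt_pivotRead_param U₀ hU₀ σ hσc hσ0 hσs T hT0 hTs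
  have hinv' : ((fderiv ℝ R (0, θ 0)).comp (ContinuousLinearMap.inr ℝ Pm (PBond P n → (specialUnitaryLogChart (Fin N)).lie))).IsInvertible := by
    rw [hθ0]; exact hinv
  have hθs : ContDiffAt ℝ ⊤ θ 0 := contDiffAt_of_implicitZero' (by simp) hRs hinv' hzero hθc
  -- the matrix field of `Φ p (σ p)` is the ambient pivot field at `(p, θ p)` near `0`
  have hamb := contDiffAt_ambientPivotField (n := n) U₀ σ hσs
  have hpair : ContDiffAt ℝ ⊤ (fun p : Pm => (p, θ p)) 0 := contDiffAt_id.prodMk hθs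
  have hcomp : ContDiffAt ℝ ⊤ (fun p : Pm => extend (iterCentralBond n)
      (fun c' => NormedSpace.exp (((θ p c' : (specialUnitaryLogChart (Fin N)).lie) : Matrix (Fin N) (Fin N) ℂ)) *
        ((U₀ (iterCentralBond n c') : SU N) : Matrix (Fin N) (Fin N) ℂ)) (coeField (σ p))) 0 := by
    have hbase : ((fun p : Pm => (p, θ p)) 0) = ((0 : Pm), (0 : PBond P n → (specialUnitaryLogChart (Fin N)).lie)) := by
      show ((0 : Pm), θ 0) = _; rw [hθ0]
    have hamb' := hamb
    rw [← hbase] at hamb'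
    exact hamb'.comp 0 hpair
  refine hcomp.congr_of_eventuallyEq ?_
  filter_upwards [hins] with p hp
  rw [← hp]
  exact coeField_pivotInsert U₀ (σ p) (θ p)

/-- ★★★ **(H1′) THE WILSON ACTION OF THE RE-SOLVED FAMILY IS `C^∞` IN THE PARAMETER** — §2 composed with the ambient Wilson action
(✓`…PivotResolveSmooth.contDiffAt_wilsonAction4_of_coeField`).  In the FOUR-POINT-DECAY use, `Pm = (datum interpolation parameter) × ℝ^{dV}`, `σ̂ (s, y) := σ_U y`,
`Φ̂ (s, y) := c.Φ (x(s), ·)`, `T (s, y) :=` the level shift of `x(s)`: the joint smoothness of `(s, y) ↦ A(c.Φ(x(s), σ_U y))` that the slice-Hessian rectangle needs.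
[cite: Balaban1985Variational, (5) p.278 and Thm 1 (8)–(10) p.279] [cite: Dieudonne1960, Ch. X §2 (10.2.1)] -/
theorem contDiffAt_wilsonAction4_resolve_param {n : ℕ} (U₀ : GaugeField P 0 (SU N))
    (hU₀ : SmallBelow (fun j => blockAvg (P := P) (j := j) (expMeanLogSU (n := Fin N))) n U₀)
    (σ : Pm → GaugeField P 0 (SU N)) (hσc : Continuous σ) (hσ0 : σ 0 = U₀) (hσs : ContDiffAt ℝ ⊤ (fun p => coeField (σ p)) 0)
    (T : Pm → GaugeField P n (SU N)) (hT0 : T 0 = Averaging.iter (fun j => blockAvg (P := P) (j := j) (expMeanLogSU (n := Fin N))) n U₀)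
    (hTs : ContDiffAt ℝ ⊤ (fun p => coeField (T p)) 0)
    (Φ : Pm → GaugeField P 0 (SU N) → GaugeField P 0 (SU N))
    (hoff : ∀ᶠ p in 𝓝 0, ∀ b, (∀ c, iterCentralBond n c ≠ b) → Φ p (σ p) b = σ p b)
    (hfib : ∀ᶠ p in 𝓝 0, Averaging.iter (fun j => blockAvg (P := P) (j := j) (expMeanLogSU (n := Fin N))) n (Φ p (σ p)) = T p)
    (hΦc : ContinuousAt (fun p => Φ p (σ p)) 0) (hself : Φ 0 U₀ = U₀)
    (hinv : ((fderiv ℝ (fun q : Pm × (PBond P n → (specialUnitaryLogChart (Fin N)).lie) => fun c : PBond P n =>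
        (isChartRep_specialUnitaryGroup (n := Fin N)).logChart
          (Averaging.iter (fun j => blockAvg (P := P) (j := j) (expMeanLogSU (n := Fin N))) n
              (extend (iterCentralBond n) (fun c' => (isChartRep_specialUnitaryGroup (n := Fin N)).expChart (q.2 c') * U₀ (iterCentralBond n c')) (σ q.1)) c *
            (T q.1 c)⁻¹)) (0, 0)).comp
        (ContinuousLinearMap.inr ℝ Pm (PBond P n → (specialUnitaryLogChart (Fin N)).lie))).IsInvertible)
    (m : WithTop ℕ∞) :
    ContDiffAt ℝ m (fun p => wilsonAction4 (Φ p (σ p))) 0 :=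
  contDiffAt_wilsonAction4_of_coeField
    ((contDiffAt_coeField_resolve_param U₀ hU₀ σ hσc hσ0 hσs T hT0 hTs Φ hoff hfib hΦc hself hinv).of_le le_top)

omit [CompleteSpace Pm] in
/-- ★ **THE RAW (C2-b) ROW OF §2 FROM THE PER-BOND ROW** (px11 g10's ✓`isInvertible_fderiv_chainRead` ∕ `chainRead_contDiffAt_surjective` shape): the slice
`R̂(0, ·)` is the diagonal of the one-variable chart-read chains (`pivotReadParam_base_eq_chainMap`), so invertible blocks give an invertible `fderiv R̂ (0,0) ∘ inr`.
[cite: Dieudonne1960, Ch. X §2 (10.2.1) (bookkeeping)] -/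
theorem isInvertible_inr_param_of_blocks {n : ℕ} (hn : n ≤ P.m + P.K) (U₀ : GaugeField P 0 (SU N))
    (σ : Pm → GaugeField P 0 (SU N)) (hσ0 : σ 0 = U₀)
    (T : Pm → GaugeField P n (SU N)) (hT0 : T 0 = Averaging.iter (fun j => blockAvg (P := P) (j := j) (expMeanLogSU (n := Fin N))) n U₀)
    (hR : DifferentiableAt ℝ (fun q : Pm × (PBond P n → (specialUnitaryLogChart (Fin N)).lie) => fun c : PBond P n =>
        (isChartRep_specialUnitaryGroup (n := Fin N)).logChart
          (Averaging.iter (fun j => blockAvg (P := P) (j := j) (expMeanLogSU (n := Fin N))) n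
              (extend (iterCentralBond n) (fun c' => (isChartRep_specialUnitaryGroup (n := Fin N)).expChart (q.2 c') * U₀ (iterCentralBond n c')) (σ q.1)) c *
            (T q.1 c)⁻¹)) ((0 : Pm), (0 : PBond P n → (specialUnitaryLogChart (Fin N)).lie)))
    (hd : ∀ c : PBond P n, DifferentiableAt ℝ (fun X : (specialUnitaryLogChart (Fin N)).lie =>
        (isChartRep_specialUnitaryGroup (n := Fin N)).logChart
          (chainMap (expMeanLogSU (n := Fin N)) n U₀ c ((isChartRep_specialUnitaryGroup (n := Fin N)).expChart X * U₀ (iterCentralBond n c)) *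
            (Averaging.iter (fun j => blockAvg (P := P) (j := j) (expMeanLogSU (n := Fin N))) n U₀ c)⁻¹)) 0)
    (hblk : ∀ c : PBond P n, (fderiv ℝ (fun X : (specialUnitaryLogChart (Fin N)).lie =>
        (isChartRep_specialUnitaryGroup (n := Fin N)).logChart
          (chainMap (expMeanLogSU (n := Fin N)) n U₀ c ((isChartRep_specialUnitaryGroup (n := Fin N)).expChart X * U₀ (iterCentralBond n c)) *
            (Averaging.iter (fun j => blockAvg (P := P) (j := j) (expMeanLogSU (n := Fin N))) n U₀ c)⁻¹)) 0).IsInvertible) :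
    ((fderiv ℝ (fun q : Pm × (PBond P n → (specialUnitaryLogChart (Fin N)).lie) => fun c : PBond P n =>
        (isChartRep_specialUnitaryGroup (n := Fin N)).logChart
          (Averaging.iter (fun j => blockAvg (P := P) (j := j) (expMeanLogSU (n := Fin N))) n
              (extend (iterCentralBond n) (fun c' => (isChartRep_specialUnitaryGroup (n := Fin N)).expChart (q.2 c') * U₀ (iterCentralBond n c')) (σ q.1)) c *
            (T q.1 c)⁻¹)) (0, 0)).comp
        (ContinuousLinearMap.inr ℝ Pm (PBond P n → (specialUnitaryLogChart (Fin N)).lie))).IsInvertible :=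
  isInvertible_inr_of_blocks hR (fun X c => pivotReadParam_base_eq_chainMap hn U₀ σ hσ0 T hT0 X c) hd hblk

end Resolve

end Summit.QuantumFields.YangMills.Theorems.FluctuationComparisonRegPrIntLS2BetaPivotResolveParam

end
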